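import Mathlib
import HarnessLib
import Summits.ValiantsHypothesis.ValiantsHypothesis.Theses.MonotoneRestoration
import Literature.Computability.AlgebraicComplexity.ArithCircuit
import Literature.Computability.AlgebraicComplexity.ArithCircuitProofs
import Literature.Computability.AlgebraicComplexity.MonotoneStructure
import Literature.Computability.AlgebraicComplexity.PermanentIrreducible
import Literature.ModelTheory.FiniteModelTheory.CkEquiv
import Summits.ValiantsHypothesis.ValiantsHypothesis.Theorems.MonotoneRestorationMonotoneRestorationQPCosetCount
import Summits.ValiantsHypothesis.ValiantsHypothesis.Theorems.MonotoneRestorationMonotoneRestorationQPSymmetricLB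
import Summits.ValiantsHypothesis.ValiantsHypothesis.Theorems.MonotoneRestorationMonotoneRestorationQPSupportSymmetrisation
import Summits.ValiantsHypothesis.ValiantsHypothesis.Theorems.MonotoneRestorationMonotoneRestorationQPSparseRegime
import Summits.ValiantsHypothesis.ValiantsHypothesis.Theorems.MonotoneRestorationMonotoneRestorationQPBeta
import Literature.Computability.AlgebraicComplexity.SymmetricArithCircuit
import Literature.Computability.AlgebraicComplexity.DawarWilsenach2025Proofs
import Literature.GroupTheory.PermutationGroups.SmallIndexSubgroups
import Summits.ValiantsHypothesis.ValiantsHypothesis.Theorems.MonotoneRestorationQP.Negative.LoadBearing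
import Summits.ValiantsHypothesis.ValiantsHypothesis.Theorems.MonotoneRestorationMonotoneRestorationQPPermSupportCount

/-! TTRL-lite variant V20775 of stmt-ValiantsHypothesis-15886 -/

set_option linter.dupNamespace false

namespace Summit.ValiantsHypothesis.ValiantsHypothesis.Theorems

open Summit.ValiantsHypothesis.ValiantsHypothesis.Theses.MonotoneRestoration
open Literature.Computability.AlgebraicComplexity

/-- TTRL-lite variant V20775 of `stub_gammaArithmetic` (stmt-ValiantsHypothesis-15886):
the third conjunct of the γ-arithmetic threshold alone forces the pointwise lower bound
`2 · (c^c + 2)² ≤ n`, because `c ≤ Nat.log 2 n + c` gives `c^c ≤ (Nat.log 2 n + c)^c`. -/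
theorem stub_gammaArithmetic_var20775 :
    ∀ (c n : ℕ), ((Nat.log 2 n + c) ^ c + 2) * ((Nat.log 2 n + c) ^ c + 2) ≤ n / 2 →
      2 * ((c ^ c + 2) * (c ^ c + 2)) ≤ n := by
  intro c n h
  have h1 : c ^ c ≤ (Nat.log 2 n + c) ^ c := Nat.pow_le_pow_left (Nat.le_add_left c _) c
  have h2 : (c ^ c + 2) * (c ^ c + 2) ≤
      ((Nat.log 2 n + c) ^ c + 2) * ((Nat.log 2 n + c) ^ c + 2) :=
    Nat.mul_le_mul (Nat.add_le_add_right h1 2) (Nat.add_le_add_right h1 2)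
  have h3 : (c ^ c + 2) * (c ^ c + 2) ≤ n / 2 := le_trans h2 h
  have h4 : (c ^ c + 2) * (c ^ c + 2) * 2 ≤ n := (Nat.le_div_iff_mul_le two_pos).mp h3
  omega

end Summit.ValiantsHypothesis.ValiantsHypothesis.Theorems
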